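import Summits.AnomalousDissipation.AnomalousDissipation.Theses.TaylorCertificates
import Summits.AnomalousDissipation.AnomalousDissipation.Theorems.FloorCertificate.Negative.WeakDuality
import Summits.AnomalousDissipation.AnomalousDissipation.Theorems.EnsembleCeiling.Negative.DiracAtoms
import Literature.Analysis.FunctionSpaces.TorusPlanarLift
import Literature.Analysis.FunctionSpaces.TorusLerayHelmholtz
import Literature.Analysis.FunctionSpaces.TorusLerayHelmholtzProofs
import Literature.Analysis.FunctionSpaces.TorusEnstrophyOrthogonality
import Literature.Analysis.FunctionSpaces.TorusClassicalNSGluing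
import Literature.Analysis.FunctionSpaces.TorusConvolution
import Literature.Analysis.FunctionSpaces.TorusTimeAverage
import Literature.Analysis.FunctionSpaces.TorusInverseLaplacianCalculus
import Literature.Analysis.FunctionSpaces.TorusSobolevSpaceProofs
import Literature.Analysis.FluidPDE.TorusClassicalH1Balance
import Literature.Analysis.FluidPDE.SteadyNavierStokesRegularity
import Literature.Analysis.FluidPDE.SteadyNavierStokesProofs
import Literature.Analysis.FluidPDE.StatisticalSolutionEnergyEq
import Literature.Barriers.AnomalousDissipation.ClassicalEulerLimitProofs

/-!
# Negative knowledge for the crux `KolmogorovFloorEnsembleCeiling` (stmt-AnomalousDissipation-14183), IIa: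
# steady residuals, their Helmholtz reduction, and planar lifts of planar steady states

Support file for `Negative/Planar.lean` (cdisprove seat `refuter-cdisprove-stmt-AnomalousDissipation-14183-0`,
2026-08-16). Torus-calculus complements in any dimension and the `T² ↪ T³` bookkeeping:

* §1 `steadyResidual ν g v = νΔv − (v·∇)v + g`; `integral_inner_steadyResidual` (all derivatives moved onto the
  test field); `divFree_meanZero_of_rep` (a smooth a.e.-representative of a state of `H` is solenoidal and mean
  zero); `residual_orthogonal_of_steadyWeak` (the `H`-weak formulation `Torus.IsSteadyWeakSolution` gives
  `R ⊥ 𝒱`); `exists_eq_gradient_of_orthogonal` (a smooth mean-zero field orthogonal to `𝒱` is a gradient — smooth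
  Helmholtz decomposition `smooth_helmholtz_holds` plus Pythagoras); `hasZeroMean_steadyResidual`.
* §2 `planarLift v = twoHalf v 0 = (v₁, v₂, 0)∘π` and its calculus from `TorusPlanarLift` (`laplacian_planarLift`,
  `convect_planarLift`, `residual_planarLift`, `gradNormSq_planarLift`, `integral_norm_sq_planarLift`,
  `hasZeroMean_planarLift`), and `planarLift_classical_steady`: if the planar residual is `∇φ`, the lift is a
  classical steady state on `T³` driven by the lifted force (its residual is `∇(φ∘π) ⊥ 𝒱(T³)`).
Nothing here asserts a Theses statement.
-/

noncomputable section

set_option linter.dupNamespace false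

open MeasureTheory UnitAddTorus
open scoped InnerProductSpace ENNReal

namespace Summit.AnomalousDissipation.AnomalousDissipation.Theorems.KolmogorovFloorEnsembleCeiling.Negative

open Literature.Analysis.FunctionSpaces Literature.Analysis.FunctionSpaces.Torus Literature.Analysis.FluidPDE
open Summit.AnomalousDissipation.AnomalousDissipation.Theses.TaylorCertificates

local notation "𝕋³" => UnitAddTorus (Fin 3)
local notation "𝕋²" => UnitAddTorus (Fin 2)
local notation "E³" => EuclideanSpace ℝ (Fin 3)
local notation "E²" => EuclideanSpace ℝ (Fin 2)

/-! ## §1 Generic torus complements (any dimension) -/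

section Generic

variable {d : Type} [Fintype d] [DecidableEq d]

/-- The Navier–Stokes generator pairing at a state, written on an a.e.-representative (any dimension;
the `Fin 3` copy is `TaylorCertificatePair.Negative.nsGeneratorPairing_of_ae`). -/
theorem nsGeneratorPairing_of_ae_rep {u : Torus.energySpace d} {w : UnitAddTorus d → EuclideanSpace ℝ d}
    (hu : ((u : Lp (EuclideanSpace ℝ d) 2 (volume : Measure (UnitAddTorus d))) : UnitAddTorus d → EuclideanSpace ℝ d) =ᵐ[volume] w)
    (ν : ℝ) (f W : UnitAddTorus d → EuclideanSpace ℝ d) :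
    Torus.nsGeneratorPairing ν f u W =
      (∫ x, ⟪f x, W x⟫_ℝ) + ν * (∫ x, ⟪w x, Torus.laplacian W x⟫_ℝ) +
        ∫ x, ⟪Torus.fderiv W x (w x), w x⟫_ℝ := by
  have h1 : (∫ x, ⟪((u : Lp (EuclideanSpace ℝ d) 2 (volume : Measure (UnitAddTorus d))) : UnitAddTorus d → EuclideanSpace ℝ d) x, Torus.laplacian W x⟫_ℝ) =
      ∫ x, ⟪w x, Torus.laplacian W x⟫_ℝ := by
    refine integral_congr_ae ?_
    filter_upwards [hu] with x hx
    rw [hx]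
  have h2 : (∫ x, ⟪Torus.fderiv W x (((u : Lp (EuclideanSpace ℝ d) 2 (volume : Measure (UnitAddTorus d))) : UnitAddTorus d → EuclideanSpace ℝ d) x), ((u : Lp (EuclideanSpace ℝ d) 2 (volume : Measure (UnitAddTorus d))) : UnitAddTorus d → EuclideanSpace ℝ d) x⟫_ℝ) =
      ∫ x, ⟪Torus.fderiv W x (w x), w x⟫_ℝ := by
    refine integral_congr_ae ?_
    filter_upwards [hu] with x hx
    rw [hx]
  unfold Torus.nsGeneratorPairing Torus.inertialPairing
  rw [h1, h2]

/-- The residual of the steady equations of a smooth field, `R = νΔv − (v·∇)v + g`. -/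
def steadyResidual (ν : ℝ) (g v : UnitAddTorus d → EuclideanSpace ℝ d) : UnitAddTorus d → EuclideanSpace ℝ d :=
  fun y => ν • Torus.laplacian v y - Torus.convect v v y + g y

omit [DecidableEq d] in
/-- The residual of smooth data is smooth. -/
theorem isSmooth_steadyResidual (ν : ℝ) {g v : UnitAddTorus d → EuclideanSpace ℝ d} (hg : IsSmooth g)
    (hv : IsSmooth v) : IsSmooth (steadyResidual ν g v) :=
  ((hv.laplacian.smul ν).sub (hv.convect hv)).add hg

/-- The pairing of the residual with a smooth field, split into its three terms with all derivatives on
the test field: `∫⟪R, w⟫ = (g, w) + ν (v, Δw) + ∫⟪Dw·v, v⟫` for smooth solenoidal `v`. -/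
theorem integral_inner_steadyResidual (ν : ℝ) {g v w : UnitAddTorus d → EuclideanSpace ℝ d}
    (hg : IsSmooth g) (hv : IsSmooth v) (hdiv : IsDivFree v) (hw : IsSmooth w) :
    ∫ x, ⟪steadyResidual ν g v x, w x⟫_ℝ =
      (∫ x, ⟪g x, w x⟫_ℝ) + ν * (∫ x, ⟪v x, Torus.laplacian w x⟫_ℝ) + ∫ x, ⟪Torus.fderiv w x (v x), v x⟫_ℝ := by
  have hlap : ∫ x, ⟪v x, Torus.laplacian w x⟫_ℝ = ∫ x, ⟪Torus.laplacian v x, w x⟫_ℝ :=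
    (Torus.integral_inner_laplacian_comm hv hw).symm
  have hconv : ∫ x, ⟪Torus.fderiv w x (v x), v x⟫_ℝ = -∫ x, ⟪Torus.convect v v x, w x⟫_ℝ := by
    change ∫ x, ⟪Torus.convect v w x, v x⟫_ℝ = _
    rw [Torus.integral_inner_convect_eq_neg hv hdiv hw hv]
    congr 1
    exact integral_congr_ae (ae_of_all _ fun x => real_inner_comm _ _)
  have i1 : Integrable (fun x => ⟪ν • Torus.laplacian v x, w x⟫_ℝ) volume := by
    have := ((hv.laplacian.inner hw).integrable).const_mul ν
    refine this.congr (ae_of_all _ fun x => ?_)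
    simp [inner_smul_left]
  have i2 : Integrable (fun x => ⟪Torus.convect v v x, w x⟫_ℝ) volume := ((hv.convect hv).inner hw).integrable
  have i3 : Integrable (fun x => ⟪g x, w x⟫_ℝ) volume := (hg.inner hw).integrable
  unfold steadyResidual
  simp_rw [inner_add_left, inner_sub_left]
  rw [integral_add ?_ i3, integral_sub i1 i2, hlap, hconv]
  · have : ∫ x, ⟪ν • Torus.laplacian v x, w x⟫_ℝ = ν * ∫ x, ⟪Torus.laplacian v x, w x⟫_ℝ := by
      rw [← integral_const_mul]
      refine integral_congr_ae (ae_of_all _ fun x => ?_)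
      simp [inner_smul_left]
    rw [this]
    ring
  · exact i1.sub i2

/-- A smooth a.e.-representative of a state of `H` is divergence free and mean zero. -/
theorem divFree_meanZero_of_rep {u : Torus.energySpace d} {v : UnitAddTorus d → EuclideanSpace ℝ d}
    (hv : IsSmooth v)
    (hu : ((u : Lp (EuclideanSpace ℝ d) 2 (volume : Measure (UnitAddTorus d))) : UnitAddTorus d → EuclideanSpace ℝ d) =ᵐ[volume] v) :
    IsDivFree v ∧ HasZeroMean v := by
  constructor
  · have hw : IsWeaklyDivFree v := (Torus.isWeaklyDivFree_of_mem_energySpace u.2).congr_ae hu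
    exact isDivFree_of_sum_mul_mFourierCoeff_eq_zero hv fun k => hw.sum_mul_mFourierCoeff_eq_zero (hv.memLp 2) k
  · have h0 := Torus.integral_eq_zero_of_mem_energySpace u.2
    unfold HasZeroMean
    rw [← h0]
    exact integral_congr_ae hu.symm

/-- **From the `H`-weak to the classical weak formulation.** A smooth a.e.-representative `v` of an
`H`-steady state `u` of `NS_ν(g)` (`g` smooth) has its residual `L²`-orthogonal to `𝒱`. -/
theorem residual_orthogonal_of_steadyWeak {ν : ℝ} {g : UnitAddTorus d → EuclideanSpace ℝ d} (hg : IsSmooth g)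
    {u : Torus.energySpace d} (hsteady : Torus.IsSteadyWeakSolution ν g u)
    {v : UnitAddTorus d → EuclideanSpace ℝ d} (hv : IsSmooth v)
    (hu : ((u : Lp (EuclideanSpace ℝ d) 2 (volume : Measure (UnitAddTorus d))) : UnitAddTorus d → EuclideanSpace ℝ d) =ᵐ[volume] v) :
    ∀ w : UnitAddTorus d → EuclideanSpace ℝ d, IsSmooth w → IsDivFree w → HasZeroMean w →
      ∫ x, ⟪steadyResidual ν g v x, w x⟫_ℝ = 0 := by
  intro w hw hdw hzw
  have h := hsteady w hw hdw hzw
  rw [nsGeneratorPairing_of_ae_rep hu] at h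
  rw [integral_inner_steadyResidual ν hg hv (divFree_meanZero_of_rep hv hu).1 hw]
  exact h

/-- **A smooth mean-zero field orthogonal to `𝒱` is a gradient** (smooth Helmholtz decomposition
`R = w₀ + ∇φ₀`, `w₀` solenoidal and — `R`, `∇φ₀` being mean zero — mean zero, hence a test field:
`0 = (R, w₀) = ‖w₀‖² + (∇φ₀, w₀) = ‖w₀‖²`). -/
theorem exists_eq_gradient_of_orthogonal {R : UnitAddTorus d → EuclideanSpace ℝ d} (hR : IsSmooth R)
    (hmean : HasZeroMean R)
    (horth : ∀ w : UnitAddTorus d → EuclideanSpace ℝ d, IsSmooth w → IsDivFree w → HasZeroMean w →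
      ∫ x, ⟪R x, w x⟫_ℝ = 0) :
    ∃ φ : UnitAddTorus d → ℝ, IsSmooth φ ∧ ∀ x, R x = Torus.gradient φ x := by
  obtain ⟨w₀, φ₀, hw₀, hφ₀, hdiv₀, -, hdec⟩ := smooth_helmholtz_holds d R hR
  have hfun : R = fun x => w₀ x + Torus.gradient φ₀ x := funext hdec
  have hzm : HasZeroMean w₀ := by
    have : HasZeroMean (fun x => w₀ x + Torus.gradient φ₀ x) := by rw [← hfun]; exact hmean
    exact (hasZeroMean_add_gradient_iff hw₀ hφ₀).1 this
  have h0 : ∫ x, ⟪R x, w₀ x⟫_ℝ = 0 := horth w₀ hw₀ hdiv₀ hzm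
  have hsplit : ∫ x, ⟪R x, w₀ x⟫_ℝ = ∫ x, ‖w₀ x‖ ^ 2 := by
    have hpt : ∀ x, ⟪R x, w₀ x⟫_ℝ = ‖w₀ x‖ ^ 2 + ⟪Torus.gradient φ₀ x, w₀ x⟫_ℝ := fun x => by
      rw [hdec x, inner_add_left, real_inner_self_eq_norm_sq]
    simp_rw [hpt]
    rw [integral_add hw₀.norm_sq.integrable (hφ₀.gradient.inner hw₀).integrable,
      integral_inner_gradient_eq_zero_of_isDivFree hw₀ hφ₀ hdiv₀, add_zero]
  rw [hsplit] at h0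
  have hae : (fun x => ‖w₀ x‖ ^ 2) =ᵐ[volume] 0 :=
    (integral_eq_zero_iff_of_nonneg (f := fun x => ‖w₀ x‖ ^ 2) (fun x => sq_nonneg _) hw₀.norm_sq.integrable).1 h0
  have heq : (fun x => ‖w₀ x‖ ^ 2) = 0 :=
    (Continuous.ae_eq_iff_eq volume (hw₀.continuous.norm.pow 2) continuous_const).1 hae
  refine ⟨φ₀, hφ₀, fun x => ?_⟩
  have hx := congrFun heq x
  simp only [Pi.zero_apply, ne_eq, OfNat.ofNat_ne_zero, not_false_eq_true, pow_eq_zero_iff, norm_eq_zero] at hx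
  rw [hdec x, hx, zero_add]

/-- The residual of a smooth solenoidal field against a mean-zero force is mean zero. -/
theorem hasZeroMean_steadyResidual (ν : ℝ) {g v : UnitAddTorus d → EuclideanSpace ℝ d} (hg : IsSmooth g)
    (hgm : HasZeroMean g) (hv : IsSmooth v) (hdiv : IsDivFree v) : HasZeroMean (steadyResidual ν g v) := by
  unfold HasZeroMean steadyResidual
  have i1 : Integrable (fun x => ν • Torus.laplacian v x) volume := hv.laplacian.integrable.smul ν
  have i2 : Integrable (fun x => Torus.convect v v x) volume := (hv.convect hv).integrable
  rw [integral_add ?_ hg.integrable, integral_sub i1 i2]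
  · have h1 : ∫ x, ν • Torus.laplacian v x = 0 := by
      rw [integral_smul, Torus.integral_laplacian_eq_zero_of_isSmooth hv, smul_zero]
    rw [h1, Torus.integral_convect_self_eq_zero hv hdiv]
    have hgm' : ∫ x, g x = 0 := hgm
    rw [hgm']
    simp
  · exact i1.sub i2

end Generic

/-! ## §2 The planar lift of a two-dimensional steady state is a three-dimensional steady state -/

section Lift

/-- The planar lift `x ↦ (v₁, v₂, 0)(x₁, x₂)` of a planar field (the `2½`-dimensional field `twoHalf v 0`). -/
abbrev planarLift (v : 𝕋² → E²) : 𝕋³ → E³ := twoHalf v 0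

/-- The zero scalar field on `T²` is smooth. -/
theorem isSmooth_zero_scalar : IsSmooth (0 : 𝕋² → ℝ) := isSmooth_const (0 : ℝ)

/-- Partial derivatives of the zero scalar field vanish. -/
theorem partialDeriv_zero_scalar (j : Fin 2) : Torus.partialDeriv j (0 : 𝕋² → ℝ) = 0 := by
  funext x
  simp [Torus.partialDeriv, Torus.lineDeriv]

/-- The Laplacian of the zero scalar field vanishes. -/
theorem laplacian_zero_scalar : Torus.laplacian (0 : 𝕋² → ℝ) = 0 := by
  have h := laplacian_iterate_zero (d := Fin 2) (F := ℝ) 1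
  rwa [Function.iterate_one] at h

/-- The gradient of the zero scalar field vanishes. -/
theorem gradient_zero_scalar : Torus.gradient (0 : 𝕋² → ℝ) = 0 := by
  funext y
  rw [gradient_eq_sum_partialDeriv ((isSmooth_zero_scalar).isContDiff (by simp))]
  simp [partialDeriv_zero_scalar]

/-- Planar lifts of smooth fields are smooth. -/
theorem isSmooth_planarLift {v : 𝕋² → E²} (hv : IsSmooth v) : IsSmooth (planarLift v) :=
  hv.twoHalf isSmooth_zero_scalar

/-- Planar lifts of solenoidal fields are solenoidal. -/
theorem isDivFree_planarLift {v : 𝕋² → E²} (hdiv : IsDivFree v) : IsDivFree (planarLift v) :=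
  hdiv.twoHalf 0

/-- The Laplacian commutes with the planar lift. -/
theorem laplacian_planarLift {v : 𝕋² → E²} (hv : IsSmooth v) :
    Torus.laplacian (planarLift v) = planarLift (Torus.laplacian v) := by
  rw [planarLift, laplacian_twoHalf hv isSmooth_zero_scalar, laplacian_zero_scalar]

/-- The convective term commutes with the planar lift. -/
theorem convect_planarLift {v : 𝕋² → E²} (hv : IsSmooth v) :
    Torus.convect (planarLift v) (planarLift v) = planarLift (Torus.convect v v) := by
  rw [planarLift, convect_twoHalf (hv.isContDiff (by simp)) ((isSmooth_zero_scalar).isContDiff (by simp))]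
  congr 1
  funext y
  simp [gradient_zero_scalar]

/-- The residual commutes with the planar lift (pointwise). -/
theorem residual_planarLift {ν : ℝ} {g v : 𝕋² → E²} (hv : IsSmooth v) (x : 𝕋³) :
    ν • Torus.laplacian (planarLift v) x - Torus.convect (planarLift v) (planarLift v) x + planarLift g x =
      planarLift (steadyResidual ν g v) x := by
  rw [laplacian_planarLift hv, convect_planarLift hv]
  simp only [planarLift, twoHalf, steadyResidual, Pi.zero_apply, ← map_smul, ← map_sub, ← map_add,
    Prod.smul_mk, Prod.mk_sub_mk, Prod.mk_add_mk, smul_zero, sub_zero, add_zero]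

/-- Squared norms of planar lifts. -/
theorem norm_sq_planarLift (v : 𝕋² → E²) (x : 𝕋³) : ‖planarLift v x‖ ^ 2 = ‖v (planarProj x)‖ ^ 2 := by
  rw [planarLift, norm_sq_twoHalf]
  simp

/-- Energies of planar lifts: `∫_{T³} ‖(v,0)‖² = ∫_{T²} ‖v‖²`. -/
theorem integral_norm_sq_planarLift {v : 𝕋² → E²} (hv : Continuous v) :
    ∫ x, ‖planarLift v x‖ ^ 2 = ∫ y, ‖v y‖ ^ 2 := by
  simp_rw [norm_sq_planarLift]
  exact integral_comp_planarProj (b := fun y => ‖v y‖ ^ 2) (hv.norm.pow 2).aestronglyMeasurable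

/-- Gradient norms of planar lifts: `‖∇(v,0)‖²_{T³} = ‖∇v‖²_{T²}`. -/
theorem gradNormSq_planarLift {v : 𝕋² → E²} (hv : IsSmooth v) : gradNormSq (planarLift v) = gradNormSq v := by
  unfold gradNormSq
  have hpt : ∀ x : 𝕋³, ∑ i, ‖partialDeriv i (planarLift v) x‖ ^ 2 =
      (fun y => ∑ j, ‖partialDeriv j v y‖ ^ 2) (planarProj x) := by
    intro x
    rw [Fin.sum_univ_castSucc]
    have hl : partialDeriv (Fin.last 2) (planarLift v) x = 0 := by
      rw [planarLift, partialDeriv_twoHalf_last]; rfl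
    rw [hl, norm_zero]
    simp only [ne_eq, OfNat.ofNat_ne_zero, not_false_eq_true, zero_pow, add_zero]
    refine Finset.sum_congr rfl fun j _ => ?_
    rw [planarLift, partialDeriv_twoHalf_castSucc (hv.isContDiff (by simp)) ((isSmooth_zero_scalar).isContDiff (by simp)),
      partialDeriv_zero_scalar, norm_sq_twoHalf]
    simp
  simp_rw [hpt]
  exact integral_comp_planarProj (b := fun y => ∑ j, ‖partialDeriv j v y‖ ^ 2)
    (continuous_finsetSum _ fun j _ => ((hv.partialDeriv j).continuous.norm.pow 2)).aestronglyMeasurable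

/-- Inner products of a planar lift against constants integrate through the projection. -/
theorem integral_inner_const_planarLift {v : 𝕋² → E²} (hv : IsSmooth v) (c : E³) :
    ∫ x, ⟪c, planarLift v x⟫_ℝ = ⟪planarProjE c, ∫ y, v y⟫_ℝ := by
  have hpt : ∀ x : 𝕋³, ⟪c, planarLift v x⟫_ℝ = (fun y => ⟪planarProjE c, v y⟫_ℝ) (planarProj x) := by
    intro x
    rw [real_inner_comm (planarLift v x) c, planarLift, inner_twoHalf_left]
    simp only [Pi.zero_apply, zero_mul, add_zero]
    exact real_inner_comm _ _
  simp_rw [hpt]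
  rw [integral_comp_planarProj (b := fun y => ⟪planarProjE c, v y⟫_ℝ)
    (continuous_const.inner hv.continuous).aestronglyMeasurable]
  exact integral_inner hv.integrable (planarProjE c)

/-- Planar lifts of mean-zero fields are mean zero. -/
theorem hasZeroMean_planarLift {v : 𝕋² → E²} (hv : IsSmooth v) (hmean : HasZeroMean v) :
    HasZeroMean (planarLift v) := by
  unfold HasZeroMean
  have h : ∀ c : E³, ⟪c, ∫ x, planarLift v x⟫_ℝ = 0 := by
    intro c
    rw [← integral_inner (isSmooth_planarLift hv).integrable c, integral_inner_const_planarLift hv c]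
    have h0 : ∫ y, v y = 0 := hmean
    rw [h0, inner_zero_right]
  exact inner_self_eq_zero.1 (h _)

/-- **The planar lift of a 2-D steady state is a 3-D steady state.** If the residual of `(v, g)` on `T²`
is a gradient `∇φ`, then `(v, 0)` solves the steady equations driven by `(g, 0)` on `T³` in the classical
weak sense of route item #3: the lifted residual is `∇(φ ∘ π)`, orthogonal to every solenoidal field. -/
theorem planarLift_classical_steady {ν : ℝ} {g v : 𝕋² → E²} (hv : IsSmooth v)
    {φ : 𝕋² → ℝ} (hφ : IsSmooth φ) (hRφ : ∀ y, steadyResidual ν g v y = Torus.gradient φ y) :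
    ∀ W : 𝕋³ → E³, IsSmooth W → IsDivFree W → HasZeroMean W →
      ∫ x, ⟪ν • Torus.laplacian (planarLift v) x - Torus.convect (planarLift v) (planarLift v) x +
        planarLift g x, W x⟫_ℝ = 0 := by
  intro W hW hdW _
  simp_rw [residual_planarLift hv]
  have hpt : ∀ x : 𝕋³, ⟪planarLift (steadyResidual ν g v) x, W x⟫_ℝ = Torus.fderiv (φ ∘ planarProj) x (W x) := by
    intro x
    rw [planarLift, inner_twoHalf_left, hRφ, Torus.inner_gradient_left, fderiv_comp_planarProj (hφ.isContDiff (by simp))]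
    simp
  simp_rw [hpt]
  exact integral_fderiv_apply_eq_zero_of_isDivFree hW hφ.comp_planarProj hdW

end Lift

end Summit.AnomalousDissipation.AnomalousDissipation.Theorems.KolmogorovFloorEnsembleCeiling.Negative
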